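import Summits.BirchSwinnertonDyer.BirchSwinnertonDyer.Theorems.AlignedTransportAtTwoMainConjectureTransportAlignedAtTwoKilfordCopyCrossLevelSquarefreePairs
import HarnessLib

/-!
# Crux C1 `MainConjectureTransportAlignedAtTwo` (stmt-BirchSwinnertonDyer-22296), line `birth`, residual (R2) `stub_lamLawKilford`, UNEQUAL conductors,
# general «factor-and-absorb»: THE GENERALISED OLD FORM `F = Σ_m R_m·m·ι_m f` THROUGH ITS `q`-EXPANSION — `a_n(F) = Σ_m R_m·m·a_{n/m}(f)`
# (existence, integrality, modular symbols) (width seat att-p3 g19; `--supports 22296`)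

THEOREMS ONLY (no `def`, no `sorry`, no named fact). Companion of `…KilfordCopyCrossLevelFactor` (the general reduction, stated for ANY level-`L` forms
`Fᵢ` with the modular symbols `((∏_ℓ R⁽ⁱ⁾_ℓ)·{∞,·}_{fᵢ})(s)`). Downstream (the level-`L` kernel letter, Hecke rows, T1⁺ rationality) the forms must be
given as FORMS, i.e. through their `q`-expansions, exactly as att-p3 g18's old lines were (`a_n(F) = a_n(f) + q·a_{n/q}(f)`,
`a_n(F_Q) = Σ_{T⊆Q}(∏T)·a_{n/∏T}(f)`). Here the `q`-expansion of the generalised old form is written through the side operator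
`R = ∏_{ℓ∈S}([1] + ρ_ℓ[ℓ] + σ_ℓ[ℓ²]) ∈ ℂ[ℕ^×]` ITSELF, acting on coefficient sequences by the weight-`2` degeneracy rule `[m]·a (n) = m·𝟙_{m∣n}·a(n/m)`:

  `a_n(F) = R.coeff.sum (fun m c ↦ c·m·𝟙_{m∣n}·a_{n/m}(f))`   («`F = Σ_m R_m·m·ι_m f`»).

* §1 `coeffAct_single`, `coeffAct_add`, **`coeffAct_mul`** (the degeneracy rule is multiplicative: `[m₁][m₂] = [m₁m₂]` on coefficient sequences).
* §2 `exists_smul_iota_coeff`, **`exists_factorForm_coeff`**: at any level `L` with `N·∏ℓ^{e_ℓ} ∣ L` (`ρ_ℓ = 0` unless `e_ℓ ≥ 1`, `σ_ℓ = 0` unless `e_ℓ ≥ 2`)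
  there is `F ∈ S₂(Γ₀(L))` with THIS `q`-expansion, integer coefficients, and `{∞, s}_F = (R·{∞,·}_f)(s)`.
* §3 **`modularSymbol_factorForm`**, `int_cuspCoeff_factorForm`: ANY `F` with this `q`-expansion has those symbols / integer coefficients
  (`q`-expansion principle `eq_of_forall_cuspCoeff_eq_gamma0`) — the form-level hypothesis used by the crux-currency wrappers of
  `…KilfordCopyCrossLevelFactorConductor`.

BSD is not proved by this; C1 is not closed by this. References: Diamond–Shurman §5.7 [DiamondShurman2005]; Cremona 1997 §2.4 [CremonaAlgorithms1997];
Atkin–Lehner 1970 §3 [AtkinLehner1970].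
-/

noncomputable section

-- justification: the `Summit.BirchSwinnertonDyer.BirchSwinnertonDyer.…` path repeats a component (route-file convention)
set_option linter.dupNamespace false
set_option autoImplicit false

open scoped MatrixGroups ModularForm Classical

open CongruenceSubgroup Complex
open Literature.NumberTheory.EllipticCurves Literature.NumberTheory.EllipticCurves.ModularForms
open Summit.BirchSwinnertonDyer.BirchSwinnertonDyer.Theorems.ThetaLayerLambdaCongruenceAtTwo
open Summit.BirchSwinnertonDyer.BirchSwinnertonDyer.Theorems.AlignedTransportAtTwoDepletedPeriodFormula
open Summit.BirchSwinnertonDyer.BirchSwinnertonDyer.Theorems.MazurTateCongruenceAtTwoR.DepletedLattice (modularSymbol_iota)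
open Summit.BirchSwinnertonDyer.BirchSwinnertonDyer.Theorems.AlignedTransportAtTwoKilfordCopyCrossLevelTools

namespace Summit.BirchSwinnertonDyer.BirchSwinnertonDyer.Theorems.AlignedTransportAtTwoKilfordCopyCrossLevelFactorForms

/-! ## §1 The degeneracy rule `[m]·a (n) = m·𝟙_{m∣n}·a(n/m)` on coefficient sequences is a multiplicative action of `ℂ[ℕ^×]` -/

/-- `(single m c)·a (n) = c·m·𝟙_{m∣n}·a(n/m)`. [folklore] -/
theorem coeffAct_single (a : ℕ → ℂ) (m : ℕ) (c : ℂ) (n : ℕ) :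
    ((MonoidAlgebra.single m c : MonoidAlgebra ℂ ℕ).coeff.sum fun m' c' ↦ c' * ((m' : ℂ) * if m' ∣ n then a (n / m') else 0)) =
      c * ((m : ℂ) * if m ∣ n then a (n / m) else 0) := by
  rw [MonoidAlgebra.coeff_single, Finsupp.sum_single_index]
  rw [zero_mul]

/-- Additivity of the degeneracy action in the operator. [folklore] -/
theorem coeffAct_add (a : ℕ → ℂ) (D₁ D₂ : MonoidAlgebra ℂ ℕ) (n : ℕ) :
    ((D₁ + D₂).coeff.sum fun m c ↦ c * ((m : ℂ) * if m ∣ n then a (n / m) else 0)) =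
      (D₁.coeff.sum fun m c ↦ c * ((m : ℂ) * if m ∣ n then a (n / m) else 0)) +
        D₂.coeff.sum fun m c ↦ c * ((m : ℂ) * if m ∣ n then a (n / m) else 0) := by
  rw [MonoidAlgebra.coeff_add, Finsupp.sum_add_index']
  · intro m; rw [zero_mul]
  · intro m b₁ b₂; rw [add_mul]

/-- **Multiplicativity of the degeneracy action**: `((D₁D₂)·a)(n) = (D₁·(D₂·a))(n)`, i.e. `[m₁]([m₂]a) = [m₁m₂]a` on coefficient sequences
(`m₁m₂ ∣ n ↔ m₁ ∣ n ∧ m₂ ∣ n/m₁`, `n/(m₁m₂) = (n/m₁)/m₂`) — the `q`-expansion shadow of `ι_{m₁} ∘ ι_{m₂} = ι_{m₁m₂}`. [cite: DiamondShurman2005, §5.7] -/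
theorem coeffAct_mul (a : ℕ → ℂ) (D₁ D₂ : MonoidAlgebra ℂ ℕ) (n : ℕ) :
    ((D₁ * D₂).coeff.sum fun m c ↦ c * ((m : ℂ) * if m ∣ n then a (n / m) else 0)) =
      D₁.coeff.sum fun m₁ c₁ ↦ c₁ * ((m₁ : ℂ) * if m₁ ∣ n then
        (D₂.coeff.sum fun m₂ c₂ ↦ c₂ * ((m₂ : ℂ) * if m₂ ∣ n / m₁ then a (n / m₁ / m₂) else 0)) else 0) := by
  rw [MonoidAlgebra.mul_def, MonoidAlgebra.coeff_finsuppSum, Finsupp.sum_sum_index]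
  · refine Finsupp.sum_congr fun m₁ _ ↦ ?_
    rw [MonoidAlgebra.coeff_finsuppSum, Finsupp.sum_sum_index]
    · -- pointwise in `m₂`
      have key : ∀ (m₂ : ℕ) (c₂ : ℂ), ((MonoidAlgebra.single (m₁ * m₂) (D₁.coeff m₁ * c₂) : MonoidAlgebra ℂ ℕ).coeff.sum
          fun m c ↦ c * ((m : ℂ) * if m ∣ n then a (n / m) else 0)) =
          D₁.coeff m₁ * ((m₁ : ℂ) * if m₁ ∣ n then c₂ * ((m₂ : ℂ) * if m₂ ∣ n / m₁ then a (n / m₁ / m₂) else 0) else 0) := by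
        intro m₂ c₂
        rw [MonoidAlgebra.coeff_single, Finsupp.sum_single_index (by rw [zero_mul])]
        by_cases h₁ : m₁ ∣ n
        · rw [if_pos h₁]
          by_cases h₂ : m₂ ∣ n / m₁
          · rw [if_pos h₂, if_pos ((Nat.dvd_div_iff_mul_dvd h₁).mp h₂), Nat.div_div_eq_div_mul]
            push_cast; ring
          · rw [if_neg h₂, if_neg (fun h ↦ h₂ ((Nat.dvd_div_iff_mul_dvd h₁).mpr h))]
            ring
        · rw [if_neg h₁, if_neg (fun h ↦ h₁ (Dvd.dvd.trans (Dvd.intro m₂ rfl) h))]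
          ring
      simp_rw [key]
      by_cases h₁ : m₁ ∣ n
      · simp only [if_pos h₁, Finsupp.mul_sum]
      · simp only [if_neg h₁, mul_zero, Finsupp.sum_fun_zero]
    · intro m; rw [zero_mul]
    · intro m b₁ b₂; rw [add_mul]
  · intro m; rw [zero_mul]
  · intro m b₁ b₂; rw [add_mul]

/-! ## §2 Existence of the generalised old form with the prescribed `q`-expansion -/

/-- One dilated summand `w·d·ι_d F₀` (or `0` if `w = 0`): `a_n = w·d·𝟙_{d∣n}·a_{n/d}(F₀)` and `{∞, s} = w·{∞, d s}_{F₀}`; the level hypothesis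
`L₀·d ∣ L` is needed only when `w ≠ 0`. [cite: DiamondShurman2005, §5.7] [cite: CremonaAlgorithms1997, §2.4] -/
theorem exists_smul_iota_coeff {L₀ L : ℕ} [NeZero L₀] [NeZero L] (F₀ : CuspForm (Gamma0 L₀) 2)
    (d : ℕ) (hd : d ≠ 0) (w : ℤ) (h : w ≠ 0 → L₀ * d ∣ L) :
    ∃ G : CuspForm (Gamma0 L) 2, (∀ n, cuspCoeff G n = (w : ℂ) * ((d : ℂ) * if d ∣ n then cuspCoeff F₀ (n / d) else 0)) ∧
      ∀ s : ℚ, modularSymbol G s = (w : ℂ) * modularSymbol F₀ ((d : ℚ) * s) := by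
  by_cases hw : w = 0
  · refine ⟨0, fun n ↦ ?_, fun s ↦ ?_⟩
    · simp [cuspCoeff, UpperHalfPlane.qExpansion_zero, hw]
    · have h0 := modularSymbol_const_smul (0 : ℂ) (0 : CuspForm (Gamma0 L) 2) s
      rw [zero_smul, zero_mul] at h0
      rw [h0, hw, Int.cast_zero, zero_mul]
  · haveI : NeZero d := ⟨hd⟩
    refine ⟨((w : ℂ) * (d : ℂ)) • iota L₀ L d 2 (h hw) F₀, fun n ↦ ?_, fun s ↦ ?_⟩
    · simp only [cuspCoeff, qExpansion_coeff_smul, qExpansion_coeff_iota, mul_assoc]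
    · have hd0 : (d : ℂ) ≠ 0 := by exact_mod_cast hd
      rw [modularSymbol_const_smul, modularSymbol_iota, mul_assoc, ← mul_assoc (d : ℂ), mul_inv_cancel₀ hd0, one_mul]

/-- **The generalised old form with prescribed `q`-expansion exists.** `f ∈ S₂(Γ₀(N))` with integer coefficients `A`; integer data `(ρ_ℓ, σ_ℓ)_{ℓ∈S}`
with exponents `e_ℓ` (`ρ_ℓ = 0` unless `e_ℓ ≥ 1`, `σ_ℓ = 0` unless `e_ℓ ≥ 2`, all `ℓ ≠ 0`); any level `L` with `N·∏_{ℓ∈S}ℓ^{e_ℓ} ∣ L`. Then there is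
`F ∈ S₂(Γ₀(L))` with `a_n(F) = R.coeff.sum (c, m ↦ c·m·𝟙_{m∣n}·a_{n/m}(f))` for `R = ∏_{ℓ∈S}([1] + ρ_ℓ[ℓ] + σ_ℓ[ℓ²])`, with integer coefficients, and with
`{∞, s}_F = (R·{∞,·}_f)(s)` — built prime by prime, `F ↦ F + ρ_ℓℓ·ι_ℓF + σ_ℓℓ²·ι_{ℓ²}F` (`coeffAct_mul`, `act_factor_mul`).
[cite: DiamondShurman2005, §5.7] [cite: CremonaAlgorithms1997, §2.4] -/
theorem exists_factorForm_coeff {N : ℕ} [NeZero N] (f : CuspForm (Gamma0 N) 2) (A : ℕ → ℤ) (hA : ∀ n, cuspCoeff f n = A n)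
    (ρ σ : ℕ → ℤ) (e : ℕ → ℕ) (S : Finset ℕ) :
    (∀ ℓ ∈ S, ℓ ≠ 0) → (∀ ℓ ∈ S, e ℓ = 0 → ρ ℓ = 0) → (∀ ℓ ∈ S, e ℓ ≤ 1 → σ ℓ = 0) →
    ∀ (L : ℕ) [NeZero L], N * ∏ ℓ ∈ S, ℓ ^ e ℓ ∣ L →
    ∃ F : CuspForm (Gamma0 L) 2,
      (∀ n, cuspCoeff F n = ((∏ ℓ ∈ S, (MonoidAlgebra.single 1 (1 : ℂ) + MonoidAlgebra.single ℓ ((ρ ℓ : ℤ) : ℂ) +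
          MonoidAlgebra.single (ℓ ^ 2) ((σ ℓ : ℤ) : ℂ)) : MonoidAlgebra ℂ ℕ).coeff.sum
            fun m c ↦ c * ((m : ℂ) * if m ∣ n then cuspCoeff f (n / m) else 0))) ∧
      (∀ n, ∃ z : ℤ, cuspCoeff F n = z) ∧
      ∀ s : ℚ, modularSymbol F s =
        ((∏ ℓ ∈ S, (MonoidAlgebra.single 1 (1 : ℂ) + MonoidAlgebra.single ℓ ((ρ ℓ : ℤ) : ℂ) +
          MonoidAlgebra.single (ℓ ^ 2) ((σ ℓ : ℤ) : ℂ)) : MonoidAlgebra ℂ ℕ).coeff.sum fun m a ↦ a * modularSymbol f ((m : ℚ) * s)) := by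
  classical
  induction S using Finset.induction_on with
  | empty =>
    intro _ _ _ L _ hL
    rw [Finset.prod_empty, mul_one] at hL
    refine ⟨toLevel0 hL 2 f, fun n ↦ ?_, fun n ↦ ⟨A n, ?_⟩, fun s ↦ ?_⟩
    · rw [Finset.prod_empty, MonoidAlgebra.one_def, coeffAct_single, Nat.cast_one, one_mul, one_mul, if_pos (one_dvd n), Nat.div_one]
      rfl
    · rw [← hA n]; rfl
    · rw [Finset.prod_empty, MonoidAlgebra.one_def, act_single, Nat.cast_one, one_mul, one_mul, modularSymbol_toLevel0]
  | insert ℓ S hℓS ih =>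
    intro hS0 hρ hσ L _ hL
    set L₀ : ℕ := N * ∏ ℓ' ∈ S, ℓ' ^ e ℓ' with hL₀
    haveI : NeZero L₀ := ⟨mul_ne_zero (NeZero.ne N)
      (Finset.prod_ne_zero_iff.mpr fun ℓ' h ↦ pow_ne_zero _ (hS0 ℓ' (Finset.mem_insert_of_mem h)))⟩
    obtain ⟨F₀, hF₀coeff, hF₀int, hF₀sym⟩ := ih (fun ℓ' h ↦ hS0 ℓ' (Finset.mem_insert_of_mem h))
      (fun ℓ' h ↦ hρ ℓ' (Finset.mem_insert_of_mem h)) (fun ℓ' h ↦ hσ ℓ' (Finset.mem_insert_of_mem h)) L₀ dvd_rfl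
    have hL₀L : L₀ * ℓ ^ e ℓ ∣ L := by
      rw [Finset.prod_insert hℓS] at hL
      rw [hL₀, show N * (∏ ℓ' ∈ S, ℓ' ^ e ℓ') * ℓ ^ e ℓ = N * (ℓ ^ e ℓ * ∏ ℓ' ∈ S, ℓ' ^ e ℓ') by ring]
      exact hL
    have hℓ0 : ℓ ≠ 0 := hS0 ℓ (Finset.mem_insert_self ℓ S)
    have h₀ : L₀ ∣ L := (Dvd.intro _ rfl).trans hL₀L
    obtain ⟨G₁, hG₁coeff, hG₁sym⟩ := exists_smul_iota_coeff (L := L) F₀ ℓ hℓ0 (ρ ℓ) (fun hw ↦ by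
      have he : 1 ≤ e ℓ := Nat.one_le_iff_ne_zero.mpr fun h ↦ hw (hρ ℓ (Finset.mem_insert_self ℓ S) h)
      exact (mul_dvd_mul_left L₀ (by simpa only [pow_one] using pow_dvd_pow ℓ he)).trans hL₀L)
    obtain ⟨G₂, hG₂coeff, hG₂sym⟩ := exists_smul_iota_coeff (L := L) F₀ (ℓ ^ 2) (pow_ne_zero 2 hℓ0) (σ ℓ) (fun hw ↦ by
      have he : 2 ≤ e ℓ := by
        by_contra h
        exact hw (hσ ℓ (Finset.mem_insert_self ℓ S) (by omega))
      exact (mul_dvd_mul_left L₀ (pow_dvd_pow ℓ he)).trans hL₀L)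
    have hcoeff : ∀ n, cuspCoeff (toLevel0 h₀ 2 F₀ + G₁ + G₂) n =
        ((∏ ℓ' ∈ insert ℓ S, (MonoidAlgebra.single 1 (1 : ℂ) + MonoidAlgebra.single ℓ' ((ρ ℓ' : ℤ) : ℂ) +
          MonoidAlgebra.single (ℓ' ^ 2) ((σ ℓ' : ℤ) : ℂ)) : MonoidAlgebra ℂ ℕ).coeff.sum
            fun m c ↦ c * ((m : ℂ) * if m ∣ n then cuspCoeff f (n / m) else 0)) := by
      intro n
      have h0' : cuspCoeff (toLevel0 h₀ 2 F₀) n = cuspCoeff F₀ n := rfl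
      rw [cuspCoeff, qExpansion_coeff_add_level0, qExpansion_coeff_add_level0, ← cuspCoeff, ← cuspCoeff, ← cuspCoeff, h0', hG₁coeff,
        hG₂coeff, Finset.prod_insert hℓS, coeffAct_mul]
      simp only [← hF₀coeff]
      rw [coeffAct_add, coeffAct_add, coeffAct_single, coeffAct_single, coeffAct_single, Nat.cast_one, one_mul, one_mul,
        if_pos (one_dvd n), Nat.div_one, Nat.cast_pow]
    refine ⟨toLevel0 h₀ 2 F₀ + G₁ + G₂, hcoeff, fun n ↦ ?_, fun s ↦ ?_⟩
    · obtain ⟨z₀, hz₀⟩ := hF₀int n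
      obtain ⟨z₁, hz₁⟩ := hF₀int (n / ℓ)
      obtain ⟨z₂, hz₂⟩ := hF₀int (n / ℓ ^ 2)
      refine ⟨z₀ + (if ℓ ∣ n then ρ ℓ * ℓ * z₁ else 0) + (if ℓ ^ 2 ∣ n then σ ℓ * ℓ ^ 2 * z₂ else 0), ?_⟩
      have h0' : cuspCoeff (toLevel0 h₀ 2 F₀) n = cuspCoeff F₀ n := rfl
      rw [cuspCoeff, qExpansion_coeff_add_level0, qExpansion_coeff_add_level0, ← cuspCoeff, ← cuspCoeff, ← cuspCoeff, h0', hG₁coeff,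
        hG₂coeff, hz₀, hz₁, hz₂]
      split_ifs <;> push_cast <;> ring
    · rw [modularSymbol_add, modularSymbol_add, modularSymbol_toLevel0, hG₁sym, hG₂sym, hF₀sym, hF₀sym, hF₀sym,
        Finset.prod_insert hℓS, act_factor_mul]

/-! ## §3 From the `q`-expansion: modular symbols and integrality of ANY such form -/

/-- **Modular symbols of the generalised old form from its `q`-expansion**: ANY `F ∈ S₂(Γ₀(L))` with
`a_n(F) = R.coeff.sum (c, m ↦ c·m·𝟙_{m∣n}·a_{n/m}(f))`, `R = ∏_{ℓ∈S}([1] + ρ_ℓ[ℓ] + σ_ℓ[ℓ²])` (data as in `exists_factorForm_coeff`), has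
`{∞, s}_F = (R·{∞,·}_f)(s)` — it IS the form of `exists_factorForm_coeff` by the `q`-expansion principle. [cite: CremonaAlgorithms1997, §2.4]
[cite: DiamondShurman2005, §5.7] -/
theorem modularSymbol_factorForm {N L : ℕ} [NeZero N] [NeZero L] (f : CuspForm (Gamma0 N) 2) (A : ℕ → ℤ) (hA : ∀ n, cuspCoeff f n = A n)
    (ρ σ : ℕ → ℤ) (e : ℕ → ℕ) (S : Finset ℕ) (hS0 : ∀ ℓ ∈ S, ℓ ≠ 0)
    (hρ : ∀ ℓ ∈ S, e ℓ = 0 → ρ ℓ = 0) (hσ : ∀ ℓ ∈ S, e ℓ ≤ 1 → σ ℓ = 0) (hL : N * ∏ ℓ ∈ S, ℓ ^ e ℓ ∣ L)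
    (F : CuspForm (Gamma0 L) 2)
    (hF : ∀ n, cuspCoeff F n = ((∏ ℓ ∈ S, (MonoidAlgebra.single 1 (1 : ℂ) + MonoidAlgebra.single ℓ ((ρ ℓ : ℤ) : ℂ) +
      MonoidAlgebra.single (ℓ ^ 2) ((σ ℓ : ℤ) : ℂ)) : MonoidAlgebra ℂ ℕ).coeff.sum
        fun m c ↦ c * ((m : ℂ) * if m ∣ n then cuspCoeff f (n / m) else 0))) (s : ℚ) :
    modularSymbol F s =
      ((∏ ℓ ∈ S, (MonoidAlgebra.single 1 (1 : ℂ) + MonoidAlgebra.single ℓ ((ρ ℓ : ℤ) : ℂ) +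
        MonoidAlgebra.single (ℓ ^ 2) ((σ ℓ : ℤ) : ℂ)) : MonoidAlgebra ℂ ℕ).coeff.sum fun m a ↦ a * modularSymbol f ((m : ℚ) * s)) := by
  obtain ⟨F', hF'coeff, -, hF'sym⟩ := exists_factorForm_coeff f A hA ρ σ e S hS0 hρ hσ L hL
  have hFF' : F = F' := eq_of_forall_cuspCoeff_eq_gamma0 fun n ↦ by rw [hF n, hF'coeff n]
  rw [hFF']
  exact hF'sym s

/-- **Integrality**: any such `F` has integer `q`-expansion (`f` has). [cite: DiamondShurman2005, §5.7] -/
theorem int_cuspCoeff_factorForm {N L : ℕ} [NeZero N] [NeZero L] (f : CuspForm (Gamma0 N) 2) (A : ℕ → ℤ) (hA : ∀ n, cuspCoeff f n = A n)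
    (ρ σ : ℕ → ℤ) (e : ℕ → ℕ) (S : Finset ℕ) (hS0 : ∀ ℓ ∈ S, ℓ ≠ 0)
    (hρ : ∀ ℓ ∈ S, e ℓ = 0 → ρ ℓ = 0) (hσ : ∀ ℓ ∈ S, e ℓ ≤ 1 → σ ℓ = 0) (hL : N * ∏ ℓ ∈ S, ℓ ^ e ℓ ∣ L)
    (F : CuspForm (Gamma0 L) 2)
    (hF : ∀ n, cuspCoeff F n = ((∏ ℓ ∈ S, (MonoidAlgebra.single 1 (1 : ℂ) + MonoidAlgebra.single ℓ ((ρ ℓ : ℤ) : ℂ) +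
      MonoidAlgebra.single (ℓ ^ 2) ((σ ℓ : ℤ) : ℂ)) : MonoidAlgebra ℂ ℕ).coeff.sum
        fun m c ↦ c * ((m : ℂ) * if m ∣ n then cuspCoeff f (n / m) else 0))) (n : ℕ) :
    ∃ z : ℤ, cuspCoeff F n = z := by
  obtain ⟨F', hF'coeff, hF'int, -⟩ := exists_factorForm_coeff f A hA ρ σ e S hS0 hρ hσ L hL
  have hFF' : F = F' := eq_of_forall_cuspCoeff_eq_gamma0 fun n ↦ by rw [hF n, hF'coeff n]
  rw [hFF']
  exact hF'int n

/-- **Rationality** (the binder of the T1⁺ carrier `ModularJacobianGaloisDataWithForms.jacobiMapForm_galAct`): any such `F` has rational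
`q`-expansion. [cite: DiamondShurman2005, §5.7] -/
theorem rat_cuspCoeff_factorForm {N L : ℕ} [NeZero N] [NeZero L] (f : CuspForm (Gamma0 N) 2) (A : ℕ → ℤ) (hA : ∀ n, cuspCoeff f n = A n)
    (ρ σ : ℕ → ℤ) (e : ℕ → ℕ) (S : Finset ℕ) (hS0 : ∀ ℓ ∈ S, ℓ ≠ 0)
    (hρ : ∀ ℓ ∈ S, e ℓ = 0 → ρ ℓ = 0) (hσ : ∀ ℓ ∈ S, e ℓ ≤ 1 → σ ℓ = 0) (hL : N * ∏ ℓ ∈ S, ℓ ^ e ℓ ∣ L)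
    (F : CuspForm (Gamma0 L) 2)
    (hF : ∀ n, cuspCoeff F n = ((∏ ℓ ∈ S, (MonoidAlgebra.single 1 (1 : ℂ) + MonoidAlgebra.single ℓ ((ρ ℓ : ℤ) : ℂ) +
      MonoidAlgebra.single (ℓ ^ 2) ((σ ℓ : ℤ) : ℂ)) : MonoidAlgebra ℂ ℕ).coeff.sum
        fun m c ↦ c * ((m : ℂ) * if m ∣ n then cuspCoeff f (n / m) else 0))) (n : ℕ) :
    ∃ q : ℚ, cuspCoeff F n = q := by
  obtain ⟨z, hz⟩ := int_cuspCoeff_factorForm f A hA ρ σ e S hS0 hρ hσ hL F hF n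
  exact ⟨z, by rw [hz]; push_cast; rfl⟩

end Summit.BirchSwinnertonDyer.BirchSwinnertonDyer.Theorems.AlignedTransportAtTwoKilfordCopyCrossLevelFactorForms

end
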